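/-
Origin: expansion seat `prover-pub-hodgecm-mc-carch-1-g3-0`, handover #CA21 r2 2026-08-20T06:22Z md5 205db14472a7 (267 l., 14 decls + 1 private; NEW additive leaf; imports #CA20 Model.ArchKTypeOfDefinite (RUN 42) only; RUN 43; smokable over the RUN-41 world + #CA20; drop-alone given #CA20; cert certs/ax-ArchKTypeOfLineOne-205db14472a7.log: rc 0 / 64 s / 0 warnings / 14/14 trio) (`HOME/mc/pub-hodgecm-mc-carch-1/pkg43/HodgeCM/Model/ArchKTypeOfLineOne.lean`, md5 205db14472a7, 267 lines);
landed by the gen-16 packager (p-g16) in gate run 43 as `HodgeCM/Model/ArchKTypeOfLineOne.lean` (verbatim).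
-/
/-
Copyright (c) 2026. Released under Apache 2.0 license as described in the file LICENSE.
Cell pub-hodgecm, MODEL layer (construction prover mc-carch-1, gen 3), BINDER-OWNERS row 12 `C`: the LINE-1 inputs (χ)₁ = `hχ₁` and
(c5)₁ = `harch₁`'s definite-type hypothesis `hdef` of the row-12 term at the S pin are RIGID — they carry no datum of E.
-/
import Summits.HodgeConjecture.HodgeCM.Model.ArchKTypeOfDefinite_2

/-!
# Row 12, line 1: the line scalar is trivial on `U(V)`, so (χ)₁ and (c5)₁ are bare integer identities

The S pin's line-1 kernel is `lineRepD … 1 = cmLineRepFin₁ … (eta₁ V S η) ∘ (frame change)` (period-1 `Model/ArchSideOf`), i.e. the pair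
Weil representation of `(U(diag frameD V), U(⟨a 1⟩))` through the CHOSEN compatible splitting `splittingOf hGR₁ = hGR₁.choose`
([GelbartRogawski1991, Prop. 3.1.1]) twisted by the scalar `c₁ = η₁ · χ₁` with

* `η₁ = eta₁ V S η = (cmEta₁ η) ∘ snd` (`η₁(v, u) = η(1, diag(1, u))`, K-1 `UnitaryDualPairSeesawCMLines` :334 — the η-split routes the
  WHOLE `U(V)`-part of E's normalising character `η` to line 0), and
* `χ₁ = cmLineChar₁ = char₄ ∘ snd` (`χ₁ = λ₄ ∘ pr₂`, K-1 `UnitaryDualPairSeesawCMLinesCollapse` :128 — the see-saw discrepancy character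
  `λ_V′` is routed to line 0 as well).

Both factors are pulled back along `snd`, hence are TRIVIAL on `U(V)(𝔸) × {1}`.  Kernel consequences (this file, 0 hypotheses):

* `lineScalar_one_eta₁_eq_one : lineScalar_one V S hGR hGR₀ hGR₁ (eta₁ V S η) = 1` (#CA3's line-1 scalar along the `ι₁`-section) and
  `archScalar_one_eq_one : archScalar_one V S hGR hGR₀ hGR₁ η = 1` (#CA20's line-1 scalar on all of `U(diag frameD V)(L ⊗ ℝ)`);
* **(χ)₁ is a bare identity on binder-2's exponents of record**: for ANY integers `eP eQ`,
  `hχ_one_iff : (∀ u ∈ Stab(x₀), c₁(u) · det(A u)^eP · d(u)^eQ = d(u)̄) ↔ eP = 0 ∧ eQ = -1` — at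
  `(eP, eQ) := lineVacExponentsOne V c (hGR₁ V c) h₁W eR eS` (#CA13, `= placeVacExponents … (hGR₁ V c) …`, binder-2's `Classical.choose` with
  only `eP − eQ = 1` pinned) the row-12 input `hχ₁` of `archKTypeOfSide`/`archKTypeOfSAFamily` (#CA17/#CA19) SAYS `lineVacExponentsOne … = (0, −1)`;
* **(c5)₁'s definite-type hypothesis is a bare identity on the definite vacuum exponents**: for ANY exponent table `a`,
  `hdef_one_iff : (∀ b ≠ v₁, ∀ u ∈ U(V)(L_b), c₁(archSingle_b u) · det(u)^{a b} = 1) ↔ ∀ b ≠ v₁, a b = 0` — at the table `a` of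
  `exists_defExponent_blockFamilyOfAt … (hGR₁ V c) …` (#CA20) the hypothesis `hdef` of `harch_one_of_defType` SAYS «`U(V)(L_b)` acts trivially on
  the line-1 vacuum at every definite `b`».

* § 4 (repair R1 in kernel form): for ANY `η₁`, `lineScalar_one … ((ν ∘ fst) · η₁) = (ν ∘ x) · lineScalar_one … η₁` (`lineScalar_one_fst_mul`), so at
  `η₁ := (ν ∘ fst) · eta₁ V S η` the line-1 scalar IS `ν ∘ x` (`lineScalar_one_fst_mul_eta₁`) and (χ)₁ / (c5)₁ become archimedean-type conditions on
  the twist `ν` (`hχ_one_twist_iff`, `twist_eta₁_mul_cmLineChar₁_apply`) — the same currency as line 0's conditions on `η`.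

READING (a located junction, reported STATUS 2026-08-20 by carch-1-g3; no ruling is made here).  Both right-hand sides are statements about the
archimedean type of `splittingOf (hGR₁ V c) = (hGR₁ V c).choose` ALONE: compatible splittings of the pair `(V, W₁)` form a torsor under the
automorphic characters of `U(V)(𝔸) × U(W₁)(𝔸)` (two compatible `s, s'` differ by a continuous character trivial on the rational points), and
twisting by `ν ∘ det_V` of archimedean type `(m_w)_w` moves `(eP, eQ) ↦ (eP + m_{v₁}, eQ + m_{v₁})` and `a b ↦ a b + m_b`; so `(0, −1)` /
`a ≡ 0` hold for SOME compatible splitting and are undecidable for the chosen one.  For line 0 the same two inputs involve `η(·, 1)|_{U(V)}` and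
are conditions on the DATA `η` (satisfiable by choice of `η`'s `V`-type); for line 1 no binder of E reaches them.  The two evident repairs —
(R1) give line 1 its own `U(V)`-twist (`eta₁' := (ν ∘ fst) · eta₁`, `eta₀' := (ν⁻¹ ∘ fst) · eta₀` for an automorphic `ν : CMAdelic L (frameD V) →* ℂˣ`,
the torus product `cmEta_torus` and every see-saw identity unchanged), or (R2) replace `hGR₁.choose` by a normalised compatible splitting —
live upstream of this lane (period-1's `ArchSideOf` + E's binder list, resp. K-1).

Nothing is cited here and nothing is minted: kernel lemmas over #CA20 `Model/ArchKTypeOfDefinite` (RUN 42); 0 records, 0 `def … : Prop`.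
-/

set_option autoImplicit false

noncomputable section

open NumberField NumberField.InfinitePlace NumberField.mixedEmbedding IsDedekindDomain
open scoped Matrix TensorProduct Classical SchwartzMap ComplexConjugate
open MulAction
open Literature.Geometry.ComplexHyperbolic.BallModel (U21 x₀ stabilizerEquivK21)
open Literature.NumberTheory.Automorphic.U21 (K21 matA sclD)
open Literature.AlgebraicGeometry.HodgeTheory
open Literature.NumberTheory.Automorphic Literature.NumberTheory.Automorphic.UnitaryGroup Literature.NumberTheory.Weil1964
open Literature.RepresentationTheory.KonnoKonno2007 Literature.RepresentationTheory.KonnoKonno2007.RealDualPair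
open Literature.NumberTheory.GelbartRogawski1991 Literature.NumberTheory.GelbartRogawski1991.UnitaryDualPair
open HodgeCM.Adelic HodgeCM.PerL34 HodgeCM.Model.HypCensus HodgeCM.Model.SupplyInstance HodgeCM.Model.ArchSideTerm

namespace HodgeCM.Model

/-! ## § 1 Two facts about characters of compact tori -/

section Generic

/-- an integer power trivial on the whole unit circle is the zeroth power (test at `exp(πi/n)`). -/
theorem int_eq_zero_of_forall_norm_one_zpow_eq_one (n : ℤ) (h : ∀ z : ℂ, ‖z‖ = 1 → z ^ n = 1) : n = 0 := by
  by_contra hn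
  have hn' : (n : ℂ) ≠ 0 := Int.cast_ne_zero.mpr hn
  have hz := h (Complex.exp ((Real.pi / n : ℝ) * Complex.I)) (Complex.norm_exp_ofReal_mul_I _)
  rw [← Complex.exp_int_mul, show (n : ℂ) * (((Real.pi / n : ℝ) : ℂ) * Complex.I) = Real.pi * Complex.I by
      push_cast; field_simp, Complex.exp_pi_mul_I] at hz
  norm_num at hz

/-- a complex number of norm one is a unitary element. -/
theorem mem_unitary_of_norm_eq_one {z : ℂ} (hz : ‖z‖ = 1) : z ∈ unitary ℂ := by
  have h1 : conj z * z = 1 := by rw [Complex.conj_mul', hz]; simp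
  have h2 : z * conj z = 1 := by rw [mul_comm]; exact h1
  exact Unitary.mem_iff.mpr ⟨h1, h2⟩

/-- `diag(z, 1) ∈ U(2)` for `‖z‖ = 1`. -/
theorem diagonal_two_mem_unitaryGroup_of_norm_eq_one {z : ℂ} (hz : ‖z‖ = 1) :
    Matrix.diagonal ![z, 1] ∈ Matrix.unitaryGroup (Fin 2) ℂ := by
  have h2 : z * conj z = 1 := by rw [Complex.mul_conj', hz]; simp
  rw [Matrix.mem_unitaryGroup_iff, Matrix.star_eq_conjTranspose, Matrix.diagonal_conjTranspose, Matrix.diagonal_mul_diagonal,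
    ← Matrix.diagonal_one]
  congr 1
  funext i
  fin_cases i <;> simp [h2]

/-- **the characters `(A, d) ↦ det(A)^eP · d^eQ` and `(A, d) ↦ d̄` of `U(2) × U(1)` agree iff `(eP, eQ) = (0, −1)`** (test at `(diag(z,1), 1)`
and `(1, z)`). -/
theorem forall_K21_det_zpow_mul_zpow_eq_star_iff (eP eQ : ℤ) :
    (∀ k : K21, (matA k).det ^ eP * sclD k ^ eQ = star (sclD k)) ↔ eP = 0 ∧ eQ = -1 := by
  constructor
  · intro h
    have hP : eP = 0 := by
      refine int_eq_zero_of_forall_norm_one_zpow_eq_one eP fun z hz => ?_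
      have hk := h (⟨Matrix.diagonal ![z, 1], diagonal_two_mem_unitaryGroup_of_norm_eq_one hz⟩, 1)
      simpa [matA, sclD, Matrix.det_diagonal, Fin.prod_univ_two] using hk
    have hQ : eQ + 1 = 0 := by
      refine int_eq_zero_of_forall_norm_one_zpow_eq_one (eQ + 1) fun z hz => ?_
      have hz0 : z ≠ 0 := fun h0 => by simp [h0] at hz
      have hk := h (1, ⟨z, mem_unitary_of_norm_eq_one hz⟩)
      have hk' : z ^ eQ = conj z := by simpa [matA, sclD] using hk
      rw [zpow_add_one₀ hz0, hk', Complex.conj_mul', hz]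
      simp
    exact ⟨hP, by omega⟩
  · rintro ⟨rfl, rfl⟩ k
    have hd : sclD k * star (sclD k) = 1 := Literature.NumberTheory.Automorphic.U21.sclD_mul_star_self k
    have hd0 : sclD k ≠ 0 := fun h0 => by simp [h0] at hd
    rw [zpow_zero, one_mul, zpow_neg, zpow_one]
    exact inv_eq_of_mul_eq_one_right hd

end Generic

/-! ## § 2 The line-1 scalar is trivial on `U(V)` -/

section LineOne

variable {L : CMField} {ι₁ : L →+* ℂ} (V : HermSpace3 L ι₁) (S : StubTree.SeesawDatum L)
variable
  (hGR : (cmSplittingDatum (L : Type) finProdFinEquiv (frameD V) (frameD_real V) (frameD_ne V) (dW S) (dW_real S) (dW_ne S)).CompatibleSplitting)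
  (hGR₀ : (cmSplittingDatum (L : Type) (e₁) (frameD V) (frameD_real V) (frameD_ne V) (lineVec (L : Type) (dW S 0))
    (fun _ => dW_real S 0) (fun _ => dW_ne S 0)).CompatibleSplitting)
  (hGR₁ : (cmSplittingDatum (L : Type) (e₁) (frameD V) (frameD_real V) (frameD_ne V) (lineVec (L : Type) (dW S 1))
    (fun _ => dW_real S 1) (fun _ => dW_ne S 1)).CompatibleSplitting)
  (η : CMAdelic (L : Type) (frameD V) × CMAdelic (L : Type) (dW S) →* ℂˣ)

/-- a character pulled back along `snd` is trivial on `(x, 1)`. -/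
private theorem comp_snd_apply_mk_one {A B C : Type*} [MulOneClass A] [MulOneClass B] [MulOneClass C] (F : B →* C) (a : A) :
    F.comp (MonoidHom.snd A B) (a, 1) = 1 := by
  simp

/-- **`χ₁(x, 1) = 1`**: K-1's line-1 see-saw character `cmLineChar₁ = char₄ ∘ snd` (`χ₁ = λ₄ ∘ pr₂`) has no `V`-part. -/
theorem cmLineChar₁_apply_mk_one (x : CMAdelic (L : Type) (frameD V)) :
    cmLineChar₁ (L : Type) finProdFinEquiv e₁ (frameD V) (frameD_real V) (frameD_ne V) (dW S) (dW_real S) (dW_ne S) hGR hGR₀ hGR₁ (x, 1) =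
      1 := by
  unfold cmLineChar₁
  exact comp_snd_apply_mk_one _ x

/-- **`η₁(x, 1) = 1`**: the S pin's line-1 twist `eta₁ V S η = cmEta₁ η ∘ snd` (`η₁(v, u) = η(1, diag(1, u))`) has no `V`-part. -/
theorem eta₁_apply_mk_one (x : CMAdelic (L : Type) (frameD V)) : eta₁ V S η (x, 1) = 1 := by
  unfold eta₁
  exact comp_snd_apply_mk_one _ x

/-- **`lineScalar_one … (eta₁ V S η) = 1`**: #CA3's line-1 scalar `u ↦ η₁(x_u, 1) · χ₁(x_u, 1)` along the `ι₁`-section is the TRIVIAL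
character of `U(2,1)` at the S pin's `η₁`. -/
theorem lineScalar_one_eta₁_eq_one : lineScalar_one V S hGR hGR₀ hGR₁ (eta₁ V S η) = 1 := by
  refine MonoidHom.ext fun u => ?_
  rw [lineScalar_one_apply, eta₁_apply_mk_one, cmLineChar₁_apply_mk_one, mul_one, MonoidHom.one_apply]

/-- **`archScalar_one … η = 1`**: #CA20's line-1 scalar `x ↦ η₁(x^𝔸, 1) · χ₁(x^𝔸, 1)` on `U(diag frameD V)(L ⊗ ℝ)` is TRIVIAL. -/
theorem archScalar_one_eq_one : archScalar_one V S hGR hGR₀ hGR₁ η = 1 := by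
  refine MonoidHom.ext fun x => ?_
  rw [archScalar_one_apply, eta₁_apply_mk_one, cmLineChar₁_apply_mk_one, mul_one, MonoidHom.one_apply]

/-! ## § 3 (χ)₁ and (c5)₁ are bare integer identities -/

/-- **(χ)₁ ⟺ `(eP, eQ) = (0, −1)`.**  For ANY integers `eP eQ`, the row-12 line-1 input shape `hχ₁` of #CA17 `archKTypeOfSAFamily` / #CA19
`archKTypeOfSide` — «`c₁(u) · det(A u)^eP · d(u)^eQ = d(u)̄` on `Stab(x₀) = U(2) × U(1)`» — holds iff `eP = 0 ∧ eQ = -1`; the input itself is the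
case `(eP, eQ) := ((lineVacExponentsOne V c (hGR₁ V c) h₁W eR eS).eP, (…).eQ)` (#CA13; binder-2's `placeVacExponents`, a `Classical.choose` with
`eP − eQ = 1` pinned and nothing else). -/
theorem hχ_one_iff (eP eQ : ℤ) :
    (∀ u : stabilizer U21 x₀,
      ((lineScalar_one V S hGR hGR₀ hGR₁ (eta₁ V S η) (u : U21) : ℂˣ) : ℂ) *
          ((matA (stabilizerEquivK21.symm u)).det ^ eP * sclD (stabilizerEquivK21.symm u) ^ eQ) =
        star (sclD (stabilizerEquivK21.symm u))) ↔ eP = 0 ∧ eQ = -1 := by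
  rw [lineScalar_one_eta₁_eq_one, ← forall_K21_det_zpow_mul_zpow_eq_star_iff]
  simp only [MonoidHom.one_apply, Units.val_one, one_mul]
  exact ⟨fun h k => by simpa only [MulEquiv.symm_apply_apply] using h (stabilizerEquivK21 k),
    fun h u => h (stabilizerEquivK21.symm u)⟩

/-- **(c5)₁'s definite-type hypothesis ⟺ `a ≡ 0` off `v₁`.**  For ANY exponent table `a`, the hypothesis `hdef` of #CA20
`harch_one_of_defType` — «`c₁(archSingle_b u) · det(u)^{a b} = 1` for every real `b ≠ v₁` and every `u ∈ U(σ_b(diag frameD V))(ℂ)`» — holds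
iff `a b = 0` at every `b ≠ v₁` (test at the central elements `z · 1`, `‖z‖ = 1`, of determinant `z³`); at the table of
`exists_defExponent_blockFamilyOfAt … (hGR₁ V c) …` this says: `U(V)(L_b)` acts TRIVIALLY on the line-1 vacuum at every definite place, under
the chosen splitting `splittingOf (hGR₁ V c)`. -/
theorem hdef_one_iff (a : {v : InfinitePlace ↥(maximalRealSubfield L) // v.IsReal} → ℤ) :
    (∀ b : {v : InfinitePlace ↥(maximalRealSubfield L) // v.IsReal}, b ≠ HypCensus.cmPlace (L : Type) ι₁ →
      ∀ u : UnitaryGroup.archLocal (L : Type) 3 (Matrix.diagonal (frameD V)) (cmPlaceOver (L : Type) b),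
        ((archScalar_one V S hGR hGR₀ hGR₁ η
            (UnitaryGroup.archSingle (↥(maximalRealSubfield L)) L (IsCMField.complexConj L) 3 (Matrix.diagonal (frameD V))
              (IsCMField.complexConj_ne_one L) (NumberField.complexConj_smul_infinitePlace (L : Type)) (cmPlaceOver (L : Type) b) u) : ℂˣ) : ℂ) *
          (((u : UnitaryGroup.archLocal (L : Type) 3 (Matrix.diagonal (frameD V)) (cmPlaceOver (L : Type) b)) : GL (Fin 3) ℂ) :
              Matrix (Fin 3) (Fin 3) ℂ).det ^ a b = 1) ↔
    ∀ b : {v : InfinitePlace ↥(maximalRealSubfield L) // v.IsReal}, b ≠ HypCensus.cmPlace (L : Type) ι₁ → a b = 0 := by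
  rw [archScalar_one_eq_one]
  simp only [MonoidHom.one_apply, Units.val_one, one_mul]
  refine forall₂_congr fun b _ => ⟨fun h => ?_, fun h u => by rw [h, zpow_zero]⟩
  have h3 : (3 : ℤ) * a b = 0 := by
    refine int_eq_zero_of_forall_norm_one_zpow_eq_one _ fun z hz => ?_
    have hz0 : z ≠ 0 := fun h0 => by simp [h0] at hz
    have hzz : (starRingEnd ℂ) ((Units.mk0 z hz0 : ℂˣ) : ℂ) * (Units.mk0 z hz0 : ℂˣ) = 1 := by
      rw [Units.val_mk0, Complex.conj_mul', hz]
      simp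
    have hu := h ⟨Units.map (Matrix.scalar (Fin 3) : ℂ →+* Matrix (Fin 3) (Fin 3) ℂ).toMonoidHom (Units.mk0 z hz0),
      scalar_mem_unitaryGroupOfForm (starRingEnd ℂ) _ (Units.mk0 z hz0) hzz⟩
    have hdet : ((Units.map (Matrix.scalar (Fin 3) : ℂ →+* Matrix (Fin 3) (Fin 3) ℂ).toMonoidHom (Units.mk0 z hz0) : GL (Fin 3) ℂ) :
        Matrix (Fin 3) (Fin 3) ℂ).det = z ^ (3 : ℕ) := by
      change ((Matrix.scalar (Fin 3)) z).det = z ^ 3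
      simp [Matrix.scalar_apply, Matrix.det_diagonal, Finset.prod_const]
    rw [zpow_mul, show z ^ (3 : ℤ) = z ^ (3 : ℕ) from zpow_natCast z 3, ← hdet]
    exact hu
  omega

/-! ## § 4 Under a `U(V)`-twist of line 1 (repair R1): the inputs become type conditions on the twist -/

/-- **the line-1 scalar under a `U(V)`-twist `ν` of `η₁`**: for ANY `η₁`, twisting by `ν ∘ fst` multiplies #CA3's line scalar by `ν` read on
the archimedean section, `c₁' (u) = ν(x_u) · c₁(u)`, `x_u = (archSectionFrameOf V u)^𝔸`. -/
theorem lineScalar_one_fst_mul (ν : CMAdelic (L : Type) (frameD V) →* ℂˣ)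
    (η₁ : CMAdelic (L : Type) (frameD V) × CMAdelicOne (L : Type) →* ℂˣ) :
    lineScalar_one V S hGR hGR₀ hGR₁ ((ν.comp (MonoidHom.fst _ _)) * η₁) =
      (ν.comp ((UnitaryGroup.archToAdelic (↥(maximalRealSubfield L)) L (IsCMField.complexConj L) 3
          (Matrix.diagonal (frameD V))).comp (archSectionFrameOf V))) *
        lineScalar_one V S hGR hGR₀ hGR₁ η₁ := by
  refine MonoidHom.ext fun u => ?_
  simp only [MonoidHom.mul_apply, lineScalar_one_apply, MonoidHom.comp_apply, MonoidHom.coe_fst, mul_assoc]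
  rfl

/-- **at the S pin's `η₁`**: `lineScalar_one … ((ν ∘ fst) · eta₁ V S η) = ν ∘ (archSectionFrameOf V)^𝔸` — with repair R1 (`eta₁' := (ν ∘ fst)·eta₁`)
the line-1 scalar IS the twist `ν` read on the section, so the row-12 input (χ)₁ becomes «`ν(x_u) · det(A u)^eP · d(u)^eQ = d(u)̄` on
`Stab(x₀)`» — an archimedean-TYPE condition on the datum `ν` at `v₁` (for `ν = ν₁ ∘ det` of `v₁`-type `t`: `t = −eP ∧ t + eQ = −1`, solvable
because `eP − eQ = 1` is pinned), exactly as (χ)₀ is one on `η`. -/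
theorem lineScalar_one_fst_mul_eta₁ (ν : CMAdelic (L : Type) (frameD V) →* ℂˣ) :
    lineScalar_one V S hGR hGR₀ hGR₁ ((ν.comp (MonoidHom.fst _ _)) * eta₁ V S η) =
      ν.comp ((UnitaryGroup.archToAdelic (↥(maximalRealSubfield L)) L (IsCMField.complexConj L) 3
        (Matrix.diagonal (frameD V))).comp (archSectionFrameOf V)) := by
  refine MonoidHom.ext fun u => ?_
  simp only [MonoidHom.mul_apply, lineScalar_one_apply, MonoidHom.comp_apply, MonoidHom.coe_fst, eta₁_apply_mk_one,
    cmLineChar₁_apply_mk_one, mul_one]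
  rfl

/-- **(χ)₁ under repair R1, unfolded**: the `hχ₁`-shape at `η₁ := (ν ∘ fst) · eta₁ V S η` is the type identity
`ν(x_u) · det(A u)^eP · d(u)^eQ = d(u)̄` on `Stab(x₀)`. -/
theorem hχ_one_twist_iff (ν : CMAdelic (L : Type) (frameD V) →* ℂˣ) (eP eQ : ℤ) :
    (∀ u : stabilizer U21 x₀,
      ((lineScalar_one V S hGR hGR₀ hGR₁ ((ν.comp (MonoidHom.fst _ _)) * eta₁ V S η) (u : U21) : ℂˣ) : ℂ) *
          ((matA (stabilizerEquivK21.symm u)).det ^ eP * sclD (stabilizerEquivK21.symm u) ^ eQ) =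
        star (sclD (stabilizerEquivK21.symm u))) ↔
    ∀ u : stabilizer U21 x₀,
      ((ν (UnitaryGroup.archToAdelic (↥(maximalRealSubfield L)) L (IsCMField.complexConj L) 3 (Matrix.diagonal (frameD V))
          (archSectionFrameOf V (u : U21))) : ℂˣ) : ℂ) *
          ((matA (stabilizerEquivK21.symm u)).det ^ eP * sclD (stabilizerEquivK21.symm u) ^ eQ) =
        star (sclD (stabilizerEquivK21.symm u)) := by
  rw [lineScalar_one_fst_mul_eta₁]
  rfl

/-- **(c5)₁ under repair R1, unfolded**: with `η₁ := (ν ∘ fst) · eta₁ V S η` the line-1 scalar on an archimedean element `x` of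
`U(diag frameD V)` is `ν(x^𝔸)` (`η₁(x^𝔸, 1) · χ₁(x^𝔸, 1) = ν(x^𝔸)`), so #CA20's definite-type hypothesis becomes
«`ν((archSingle_b u)^𝔸) · det(u)^{a b} = 1`» — a type condition on `ν` at each definite `b` (`type_b(ν) = −a b` for `ν = ν₁ ∘ det`). -/
theorem twist_eta₁_mul_cmLineChar₁_apply (ν : CMAdelic (L : Type) (frameD V) →* ℂˣ) (x : CMAdelic (L : Type) (frameD V)) :
    ((ν.comp (MonoidHom.fst _ _)) * eta₁ V S η : CMAdelic (L : Type) (frameD V) × CMAdelicOne (L : Type) →* ℂˣ) (x, 1) *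
        cmLineChar₁ (L : Type) finProdFinEquiv e₁ (frameD V) (frameD_real V) (frameD_ne V) (dW S) (dW_real S) (dW_ne S) hGR hGR₀ hGR₁ (x, 1) =
      ν x := by
  rw [MonoidHom.mul_apply, eta₁_apply_mk_one, cmLineChar₁_apply_mk_one, mul_one, mul_one, MonoidHom.comp_apply, MonoidHom.coe_fst]

end LineOne

end HodgeCM.Model

end
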